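import Mathlib.RingTheory.Ideal.Operations
import Mathlib.Algebra.BigOperators.Group.Finset.Basic
import Mathlib.Algebra.Order.BigOperators.Group.Finset
import Mathlib.Data.Rat.Cast.Order
import Mathlib.Tactic.Linarith
import Mathlib.Tactic.Positivity
import HarnessLib

/-!
# Crux `FrobeniusLadder.FRationalResolution` (stmt-ResolutionOfSingularities-15317), line `redirect`,
# stub `stub_diagonalizableQuotientResolution` — SUBSTITUTION-CLOSED monomial centres (lane W of memo
# MEMO-15317-leafhand4-g3: intrinsic centres for the `K ≠ K̄` isolated case)

The descent datum of `…DescentDatumCentre` (✓ p827270) for a monomial centre `J = (y^u : u ∈ Ĩ)` at an OFF-DIAGONAL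
point `𝔚` (✓ p827432 `map_includeLeft_le_of_offDiagonal`) asks that `J` be carried into itself by the comparison of
the two chart structures at `𝔚`. On the cover (the `A`-graded regular algebra `S` of the quotient chart) that
comparison sends each homogeneous parameter `y_l` (weight `c l ∈ A`) to an element of the ideal spanned by the
monomials of weight `c (π l)` in the other parameter system (`π` the permutation of weights induced on
`𝔪/𝔪²`). This file isolates the two elementary facts which make the centres coming from CUBE-RAY fans (all new rays
of the regular subdivision are lattice points of the half-open unit parallelotope of the cone) stable under every
such substitution — no chart compatibility ("G-stable chart") is then needed:

* `apply_le_sum_of_weight_eq` — **parallelotope substitution inequality**: if `v ∈ N` (i.e. `⟨m, v⟩ ∈ ℤ` for every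
  integer exponent `m` of weight `0`) lies in the half-open unit cube and `u ∈ ℕⁿ` has weight `c l₀`, then
  `v l₀ ≤ ⟨u, v⟩` (both are `≡ ⟨e_{l₀}, v⟩ (mod ℤ)`, the left side is the least non-negative representative);
* `sum_map_le_of_rel`, `le_of_rel` — hence a FULL substitution (`Multiset.Rel`: every factor `y_l` of a monomial
  replaced by a monomial of weight `c (π l)`) can only increase the pairing with a cube ray, so the order conditions
  `f v ≤ ⟨·, v⟩` defining the centre survive;
* `map_prod_mem_span_of_rel` — **ring form of substitution**: if `θ (y l) ∈ (z^{u'} : R l u')` for every `l`, then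
  `θ (∏ y_{lᵢ}) ∈ (z^U : U ∈ T)` as soon as every full `R`-substitution of the factor list sums into `T`;
* `map_prod_mem_span_of_cube_rays` — the two combined: `θ` carries every monomial of the cube-ray centre (read
  through `π`) into the cube-ray centre in the other parameters;
* `sum_map_map_eq_sum_count`, `prod_map_eq_prod_pow_count` — bookkeeping between factor lists and exponent vectors.

Honest label: elementary combinatorics/algebra for a DESIGN (lane W); its consumers — the comparison of the two covers
at an off-diagonal point (W2) and the existence of symmetric cube-ray regular subdivisions (W4, verified by search for
all 454 isolated cyclic quotient threefold singularities `1/r(1,a,b)`, `r ≤ 17`) — are NOT in the tree. No stub closed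
by name. No definitions, no named facts, no sorry. [folklore; cite: Fulton1993Toric, §2.6] [cite: KempfEtAl1973, Ch. I §2]
-/

-- single-problem summit: the doubled namespace component is forced
set_option linter.dupNamespace false

namespace Summit.ResolutionOfSingularities.ResolutionOfSingularities.Theorems.FRationalResolution.SubstitutionClosedCentres

open Finset

variable {n : ℕ} {A : Type} [AddCommGroup A]

/-- **Parallelotope substitution inequality.** Let `c : Fin n → A` be weights, `v : Fin n → ℚ` a point of the dual
lattice `N` (integral pairing with every integer exponent of weight `0`) lying in the half-open unit cube, and
`u ∈ ℕⁿ` an exponent of weight `c l₀`. Then `v l₀ ≤ Σ l, u l * v l`. [folklore; cite: Fulton1993Toric, §2.6] -/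
theorem apply_le_sum_of_weight_eq (c : Fin n → A) (v : Fin n → ℚ)
    (hvN : ∀ m : Fin n → ℤ, ∑ l, m l • c l = 0 → ∃ z : ℤ, ∑ l, (m l : ℚ) * v l = z)
    (hv0 : ∀ l, 0 ≤ v l) (hv1 : ∀ l, v l < 1)
    (u : Fin n → ℕ) (l₀ : Fin n) (hu : ∑ l, u l • c l = c l₀) :
    v l₀ ≤ ∑ l, (u l : ℚ) * v l := by
  classical
  -- the integer exponent `u - e_{l₀}` has weight `0`
  have hw : ∑ l, (fun l => (u l : ℤ) - if l = l₀ then 1 else 0) l • c l = 0 := by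
    simp only [sub_smul, Finset.sum_sub_distrib, ite_smul, one_smul, zero_smul, Finset.sum_ite_eq',
      Finset.mem_univ, if_true, natCast_zsmul, hu, sub_self]
  obtain ⟨z, hz⟩ := hvN _ hw
  have hz' : ∑ l, (u l : ℚ) * v l - v l₀ = z := by
    rw [← hz]
    simp only [Int.cast_sub, Int.cast_natCast, sub_mul, Finset.sum_sub_distrib]
    congr 1
    rw [Finset.sum_eq_single l₀]
    · simp
    · intro b _ hb
      simp [hb]
    · intro h
      exact absurd (Finset.mem_univ l₀) h
  have hS : 0 ≤ ∑ l, (u l : ℚ) * v l :=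
    Finset.sum_nonneg fun l _ => mul_nonneg (Nat.cast_nonneg _) (hv0 l)
  have hz0 : (0 : ℤ) ≤ z := by
    have h : (-1 : ℚ) < z := by
      rw [← hz']
      linarith [hv1 l₀]
    have h' : (-1 : ℤ) < z := by exact_mod_cast h
    omega
  have hz0' : (0 : ℚ) ≤ z := by exact_mod_cast hz0
  linarith

/-- **A full substitution can only increase the pairing with a cube ray.** If `M` is obtained from the factor list
`m` by replacing each factor `l` by an exponent of weight `c (π l)` (`Multiset.Rel`), then for a cube point `v ∈ N`:
`Σ_{l ∈ m} v (π l) ≤ ⟨M.sum, v⟩`. [folklore; cite: Fulton1993Toric, §2.6] -/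
theorem sum_map_le_of_rel (c : Fin n → A) (π : Fin n → Fin n) (v : Fin n → ℚ)
    (hvN : ∀ m : Fin n → ℤ, ∑ l, m l • c l = 0 → ∃ z : ℤ, ∑ l, (m l : ℚ) * v l = z)
    (hv0 : ∀ l, 0 ≤ v l) (hv1 : ∀ l, v l < 1)
    {m : Multiset (Fin n)} {M : Multiset (Fin n → ℕ)}
    (hrel : Multiset.Rel (fun l u' => ∑ i, u' i • c i = c (π l)) m M) :
    ((m.map π).map v).sum ≤ ∑ i, (M.sum i : ℚ) * v i := by
  induction hrel with
  | zero => simp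
  | @cons a b as bs hab _ ih =>
    rw [Multiset.map_cons, Multiset.map_cons, Multiset.sum_cons, Multiset.sum_cons]
    have hsplit : ∑ i, ((b + bs.sum) i : ℚ) * v i = ∑ i, (b i : ℚ) * v i + ∑ i, (bs.sum i : ℚ) * v i := by
      rw [← Finset.sum_add_distrib]
      refine Finset.sum_congr rfl fun i _ => ?_
      rw [Pi.add_apply, Nat.cast_add, add_mul]
    rw [hsplit]
    exact add_le_add (apply_le_sum_of_weight_eq c v hvN hv0 hv1 b (π a) hab) ih

/-- **Cube-ray centres are closed under full substitutions.** With `rays` a set of cube points of `N` and `f` any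
function on them, if the factor list `m` read through `π` satisfies the order conditions `f v ≤ Σ_{l ∈ m} v (π l)`
for all `v ∈ rays`, then so does (the exponent sum of) every full substitution `M` of `m`.
[folklore; cite: KempfEtAl1973, Ch. I §2] -/
theorem le_of_rel (c : Fin n → A) (π : Fin n → Fin n) (rays : Set (Fin n → ℚ))
    (hN : ∀ v ∈ rays, ∀ m : Fin n → ℤ, ∑ l, m l • c l = 0 → ∃ z : ℤ, ∑ l, (m l : ℚ) * v l = z)
    (h0 : ∀ v ∈ rays, ∀ l, 0 ≤ v l) (h1 : ∀ v ∈ rays, ∀ l, v l < 1)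
    (f : (Fin n → ℚ) → ℚ) {m : Multiset (Fin n)} {M : Multiset (Fin n → ℕ)}
    (hrel : Multiset.Rel (fun l u' => ∑ i, u' i • c i = c (π l)) m M)
    (hm : ∀ v ∈ rays, f v ≤ ((m.map π).map v).sum) :
    ∀ v ∈ rays, f v ≤ ∑ i, (M.sum i : ℚ) * v i := fun v hv =>
  (hm v hv).trans (sum_map_le_of_rel c π v (hN v hv) (h0 v hv) (h1 v hv) hrel)

/-- **Ring form of substitution.** Let `θ : E → E'` be a ring map, `y : Fin n → E`, `z : Fin n → E'`, and suppose
`θ (y l)` lies in the ideal spanned by the monomials `z^{u'}` with `R l u'`, for every `l`. If every full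
`R`-substitution `M` of the factor list `m` has `M.sum ∈ T`, then `θ (∏_{l ∈ m} y l)` lies in the ideal spanned by
the monomials `z^U`, `U ∈ T`. [folklore] -/
theorem map_prod_mem_span_of_rel {E E' : Type} [CommRing E] [CommRing E'] (θ : E →+* E')
    (y : Fin n → E) (z : Fin n → E') (R : Fin n → (Fin n → ℕ) → Prop)
    (hθ : ∀ l, θ (y l) ∈ Ideal.span ((fun u : Fin n → ℕ => ∏ i, z i ^ u i) '' {u | R l u})) :
    ∀ (m : Multiset (Fin n)) (T : Set (Fin n → ℕ)),
      (∀ M : Multiset (Fin n → ℕ), Multiset.Rel R m M → M.sum ∈ T) →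
      θ (m.map y).prod ∈ Ideal.span ((fun u : Fin n → ℕ => ∏ i, z i ^ u i) '' T) := by
  intro m
  induction m using Multiset.induction_on with
  | empty =>
    intro T hT
    have h0 : (0 : Fin n → ℕ) ∈ T := by
      have := hT 0 Multiset.Rel.zero
      simpa using this
    rw [Multiset.map_zero, Multiset.prod_zero, map_one]
    refine Ideal.subset_span ⟨0, h0, ?_⟩
    simp
  | cons a m ih =>
    intro T hT
    rw [Multiset.map_cons, Multiset.prod_cons, map_mul]
    -- every element of the span of the allowed substitutes of `y a` multiplies `θ (rest)` into the target
    have key : ∀ x ∈ Ideal.span ((fun u : Fin n → ℕ => ∏ i, z i ^ u i) '' {u | R a u}),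
        x * θ (m.map y).prod ∈ Ideal.span ((fun u : Fin n → ℕ => ∏ i, z i ^ u i) '' T) := by
      intro x hx
      refine Submodule.span_induction ?_ ?_ ?_ ?_ hx
      · rintro _ ⟨u', hu', rfl⟩
        -- induction hypothesis with the shifted target `{w | u' + w ∈ T}`
        have hT' : ∀ M : Multiset (Fin n → ℕ), Multiset.Rel R m M → M.sum ∈ {w | u' + w ∈ T} := by
          intro M hM
          have h := hT (u' ::ₘ M) (Multiset.Rel.cons hu' hM)
          rwa [Multiset.sum_cons] at h
        have hrest := ih {w | u' + w ∈ T} hT'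
        -- `z^{u'} · (z^w : u' + w ∈ T) ⊆ (z^U : U ∈ T)`
        have hmul : Ideal.span {∏ i, z i ^ u' i} *
            Ideal.span ((fun u : Fin n → ℕ => ∏ i, z i ^ u i) '' {w | u' + w ∈ T}) ≤
            Ideal.span ((fun u : Fin n → ℕ => ∏ i, z i ^ u i) '' T) := by
          rw [Ideal.span_mul_span']
          refine Ideal.span_mono ?_
          rintro _ ⟨s, hs, t, ⟨w, hw, rfl⟩, rfl⟩
          rw [Set.mem_singleton_iff] at hs
          subst hs
          refine ⟨u' + w, hw, ?_⟩
          simp only [Pi.add_apply, pow_add, Finset.prod_mul_distrib]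
        exact hmul (Ideal.mul_mem_mul (Ideal.subset_span rfl) hrest)
      · simp
      · intro x₁ x₂ _ _ h₁ h₂
        rw [add_mul]
        exact Ideal.add_mem _ h₁ h₂
      · intro r x _ h
        rw [smul_eq_mul, mul_assoc]
        exact Ideal.mul_mem_left _ r h
    exact key _ (hθ a)

/-- **Substitution stability of cube-ray centres (lane W, the two facts combined).** Weights `c`, weight
permutation `π`, cube rays `rays ⊆ N`, order function `f`; a ring map `θ` with
`θ (y l) ∈ (z^{u'} : wt u' = c (π l))` for every `l`. Then for every factor list `m` whose `π`-reading satisfies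
the order conditions, `θ (∏_{l ∈ m} y l)` lies in the ideal spanned by the monomials `z^U` over the exponents `U`
satisfying the order conditions. [folklore; cite: KempfEtAl1973, Ch. I §2] -/
theorem map_prod_mem_span_of_cube_rays {E E' : Type} [CommRing E] [CommRing E'] (θ : E →+* E')
    (y : Fin n → E) (z : Fin n → E') (c : Fin n → A) (π : Fin n → Fin n) (rays : Set (Fin n → ℚ))
    (hN : ∀ v ∈ rays, ∀ m : Fin n → ℤ, ∑ l, m l • c l = 0 → ∃ z : ℤ, ∑ l, (m l : ℚ) * v l = z)
    (h0 : ∀ v ∈ rays, ∀ l, 0 ≤ v l) (h1 : ∀ v ∈ rays, ∀ l, v l < 1) (f : (Fin n → ℚ) → ℚ)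
    (hθ : ∀ l, θ (y l) ∈
      Ideal.span ((fun u : Fin n → ℕ => ∏ i, z i ^ u i) '' {u | ∑ i, u i • c i = c (π l)}))
    (m : Multiset (Fin n)) (hm : ∀ v ∈ rays, f v ≤ ((m.map π).map v).sum) :
    θ (m.map y).prod ∈ Ideal.span ((fun u : Fin n → ℕ => ∏ i, z i ^ u i) ''
      {U | ∀ v ∈ rays, f v ≤ ∑ i, (U i : ℚ) * v i}) :=
  map_prod_mem_span_of_rel θ y z (fun l u' => ∑ i, u' i • c i = c (π l)) hθ m _
    fun _ hM => le_of_rel c π rays hN h0 h1 f hM hm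

/-- Bookkeeping: the pairing of a factor list with `v` is the pairing of its exponent vector (`Multiset.count`)
with `v`. [folklore] -/
theorem sum_map_map_eq_sum_count (π : Fin n → Fin n) (v : Fin n → ℚ) (m : Multiset (Fin n)) :
    ((m.map π).map v).sum = ∑ l, ((m.map π).count l : ℚ) * v l := by
  classical
  rw [Finset.sum_multiset_map_count]
  rw [← Finset.sum_subset (Finset.subset_univ (m.map π).toFinset)]
  · refine Finset.sum_congr rfl fun l _ => ?_
    rw [nsmul_eq_mul]
  · intro l _ hl
    rw [Multiset.mem_toFinset] at hl
    rw [Multiset.count_eq_zero_of_notMem hl]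
    simp

/-- Bookkeeping: the product of a factor list is the monomial of its exponent vector. [folklore] -/
theorem prod_map_eq_prod_pow_count {E : Type} [CommRing E] (y : Fin n → E) (m : Multiset (Fin n)) :
    (m.map y).prod = ∏ l, y l ^ m.count l := by
  classical
  rw [Finset.prod_multiset_map_count]
  rw [← Finset.prod_subset (Finset.subset_univ m.toFinset)]
  intro l _ hl
  rw [Multiset.mem_toFinset] at hl
  rw [Multiset.count_eq_zero_of_notMem hl, pow_zero]

/-- **Indecomposable lattice points of the orthant are cube points.** If `v ∈ N ∩ σ` (`σ` the positive orthant, `N ⊇ ℤⁿ` the dual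
lattice of the weight-`0` exponents) is not a basis vector `e_l` and is not the sum of two nonzero points of `N ∩ σ`, then every coordinate
of `v` is `< 1`. Hence the rays of a Hilb-desingularization (all rays in the Hilbert basis of `σ ∩ N`, [Bouvier–Gonzalez-Sprinberg 1995])
are cube rays in the sense of `apply_le_sum_of_weight_eq`. [folklore; cite: Fulton1993Toric, §2.6] -/
theorem apply_lt_one_of_indecomposable (c : Fin n → A) (v : Fin n → ℚ)
    (hvN : ∀ m : Fin n → ℤ, ∑ l, m l • c l = 0 → ∃ z : ℤ, ∑ l, (m l : ℚ) * v l = z)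
    (hv0 : ∀ l, 0 ≤ v l) (hne : ∀ l, v ≠ Pi.single l 1)
    (hind : ∀ u w : Fin n → ℚ, (∀ l, 0 ≤ u l) → (∀ l, 0 ≤ w l) →
      (∀ m : Fin n → ℤ, ∑ l, m l • c l = 0 → ∃ z : ℤ, ∑ l, (m l : ℚ) * u l = z) →
      (∀ m : Fin n → ℤ, ∑ l, m l • c l = 0 → ∃ z : ℤ, ∑ l, (m l : ℚ) * w l = z) →
      v = u + w → u = 0 ∨ w = 0) :
    ∀ l, v l < 1 := by
  classical
  intro l₀
  by_contra h
  rw [not_lt] at h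
  set e : Fin n → ℚ := Pi.single l₀ 1 with hedef
  have he_apply : ∀ l, e l = if l = l₀ then 1 else 0 := fun l => by
    simp only [hedef, Pi.single_apply]
  have he0 : ∀ l, 0 ≤ e l := fun l => by
    rw [he_apply]
    split_ifs <;> norm_num
  have heN : ∀ m : Fin n → ℤ, ∑ l, m l • c l = 0 → ∃ z : ℤ, ∑ l, (m l : ℚ) * e l = z := by
    intro m _
    refine ⟨m l₀, ?_⟩
    rw [Finset.sum_eq_single l₀]
    · simp [he_apply]
    · intro b _ hb
      simp [he_apply, hb]
    · intro hh
      exact absurd (Finset.mem_univ l₀) hh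
  have hw0 : ∀ l, 0 ≤ (v - e) l := by
    intro l
    rw [Pi.sub_apply, he_apply]
    split_ifs with hl
    · subst hl
      linarith
    · linarith [hv0 l]
  have hwN : ∀ m : Fin n → ℤ, ∑ l, m l • c l = 0 → ∃ z : ℤ, ∑ l, (m l : ℚ) * (v - e) l = z := by
    intro m hm
    obtain ⟨z₁, hz₁⟩ := hvN m hm
    obtain ⟨z₂, hz₂⟩ := heN m hm
    refine ⟨z₁ - z₂, ?_⟩
    simp only [Pi.sub_apply, mul_sub, Finset.sum_sub_distrib, hz₁, hz₂, Int.cast_sub]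
  rcases hind e (v - e) he0 hw0 heN hwN (by abel) with h0 | h0
  · have h1 := congr_fun h0 l₀
    rw [he_apply, if_pos rfl] at h1
    exact one_ne_zero h1
  · exact hne l₀ (sub_eq_zero.mp h0)

/-- **Weight symmetries preserve the dual lattice.** If the permutation `π` of the variables permutes the weights up to an additive
endomorphism `τ` of `A` (`c (π l) = τ (c l)`), then `v ∘ π` is a point of `N` whenever `v` is (so a `W`-invariant set of cube rays is
stable under `v ↦ v ∘ π`, as used in `map_prod_mem_span_of_cube_rays`). [folklore] -/
theorem dualLattice_comp_perm (c : Fin n → A) (τ : A →+ A) (π : Equiv.Perm (Fin n)) (hπ : ∀ l, c (π l) = τ (c l))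
    (v : Fin n → ℚ) (hvN : ∀ m : Fin n → ℤ, ∑ l, m l • c l = 0 → ∃ z : ℤ, ∑ l, (m l : ℚ) * v l = z) :
    ∀ m : Fin n → ℤ, ∑ l, m l • c l = 0 → ∃ z : ℤ, ∑ l, (m l : ℚ) * v (π l) = z := by
  intro m hm
  have hw : ∑ l, (m ∘ π.symm) l • c l = 0 := by
    have h1 : ∑ l, (m ∘ π.symm) l • c l = ∑ l, m l • c (π l) := by
      rw [← Equiv.sum_comp π (fun l => (m ∘ π.symm) l • c l)]
      simp [Function.comp, Equiv.symm_apply_apply]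
    rw [h1]
    simp_rw [hπ, ← map_zsmul τ, ← map_sum, hm, map_zero]
  obtain ⟨z, hz⟩ := hvN _ hw
  refine ⟨z, ?_⟩
  rw [← hz, ← Equiv.sum_comp π (fun l => ((m ∘ π.symm) l : ℚ) * v l)]
  simp [Function.comp, Equiv.symm_apply_apply]

end Summit.ResolutionOfSingularities.ResolutionOfSingularities.Theorems.FRationalResolution.SubstitutionClosedCentres
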